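import Summits.BirchSwinnertonDyer.BirchSwinnertonDyer.Theorems.GenusKolyvaginAtTwoGenusPrimitiveSupplyAtTwoShaPlaneDoorTwin
import Summits.BirchSwinnertonDyer.BirchSwinnertonDyer.Theorems.ByReductionTypeAtTwoRankOneAtTwoBigImageOddLocalOneDoorTranspositionParity
import Summits.BirchSwinnertonDyer.Rank1Residual.F1Sign2.HeegnerOddDoorFieldAtTwo
import HarnessLib

/-!
# Route `GenusKolyvaginAtTwo`, crux #2 `GenusPrimitiveSupplyAtTwo` (stmt-BirchSwinnertonDyer-22136):
# THE `𝔽₂[Gal(K/ℚ)]`-SHAPE OF `Sel₂(W_K/K)` AT A DOOR IN CARDINALS — `u ≤ k ≤ 2u − 1` UNCONDITIONALLY, `k` odd behind `h14`: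
# DESC-29-M `F1Sign2.DoorFieldSelmerBoundsAtTwo` BY NAME behind `h14`

Width seat `bsd-line-gk2-p5` g18 (cell `bsd-f1-sign2`, SUPPLY lineage of crux 22136), file 54 of the series; sequel of files 52/53. THEOREMS ONLY
(no definition, no new named fact, no `sorry`); helper `--supports stmt-BirchSwinnertonDyer-22136`; no item is closed; BSD is not proved by any of this.

WHAT. -desc's DESC-29-M (`F1Sign2/HeegnerOddDoorFieldAtTwo.lean`, -ty p697070; REF1 §173 THEOREM-GRADE IN PRINT-ASSEMBLY): for `W/ℚ` globally minimal with
`E(ℚ)[2] = 0` and `K` a door field, with `2^u = max(#Sel₂ W, #Sel₂ W^{(d_K)})`, `2^k = #Sel₂(W_K/K)`: `u ≤ k ≤ 2u − 1` and `k` odd.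

* §222 UNCONDITIONAL: `max(#Sel₂ W, #Sel₂ W^{(d_K)}) = #Sel₂^{rel ∞}(W)` — THEOREM A's dichotomy DECIDED (files 16/17/40/41: exactly one of `Sel₂(W)`,
  `Sel_𝔓(A_χ) ≅ Sel₂(W^{(d_K)})` is `Sel₂^{rel ∞}(W)`, the other is `Sel₂^{str ∞}(W)` of index `2`, `Δ_W > 0` being forced by the door); then file 53's
  COUNT SKELETON `#Sel₂(W_K/K) = #Sel₂^{rel ∞}(W) · r`, `r ≤ #Sel₂^{str ∞}(W) = #Sel₂^{rel ∞}(W)/2` gives **`max ≤ #Sel₂(W_K/K)` and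
  `2·#Sel₂(W_K/K) ≤ max²`** (`doorFieldSelmerBounds_of_isDoorField`).
* §223 behind `h14` (the tree's named fact `Monsky1996_lemma14b_twoSelmerRank_parity`, Kramer Thm. 1 parity + Thm. 2, NOT proved here): `k` odd (file 52
  `not_isSquare_fieldSelmerTwoCard_of_monsky`), hence **`doorFieldSelmerBoundsAtTwo_of_monsky : Monsky1996_lemma14b_twoSelmerRank_parity →
  F1Sign2.DoorFieldSelmerBoundsAtTwo`** (DESC-29-M BY NAME, CONDITIONAL on `h14`).

Honest framing: Kramer 1981 Thm. 1 / Prop. 6 / Prop. 7 + Mazur–Rubin Lemma 3.2 bookkeeping (finiteness-free, Monsky-free for the two inequalities — the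
row's docstring routes `u = 1 + dim Φ` through Monsky parity; here it comes from the DECIDED dichotomy instead) plus `h14` for the parity clause only;
kernel-new; beyond-print theorem: no. Crux 22136 stays OPEN exactly at (U) 24947 ∧ (CONV₂) 19220/24948. BSD is not proved by any of this.

References: [Kramer1981] Thm. 1, Prop. 6, Prop. 7, Thm. 2; [MazurRubin2010] Lemma 3.2, Prop. 3.3; [Monsky1996] Lemma 1.4(b).
-/

set_option linter.dupNamespace false -- tree convention: `Summit.BirchSwinnertonDyer.BirchSwinnertonDyer.Theorems` (summit = sub-problem)
set_option autoImplicit false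

noncomputable section

open scoped Classical

namespace Summit.BirchSwinnertonDyer.BirchSwinnertonDyer.Theorems.GenusKolyArch

open WeierstrassCurve NumberField Field
open Literature.NumberTheory.EllipticCurves Literature.NumberTheory.GaloisRepresentations
open Summit.BirchSwinnertonDyer.Rank1Residual.X11b.KummerPT (kummerStrict)
open Summit.BirchSwinnertonDyer.Rank1Residual.F1Sign2 (selmerGroupRelaxedAtInfinityAtTwo DescAdmissible NoRationalTwoTorsion
  selmerTwoCard twistSelmerTwoCard IsDoorField fieldSelmerTwoCard DoorFieldSelmerBoundsAtTwo)

/-! ## §222 `max(#Sel₂ W, #Sel₂ W^{(d)}) = #Sel₂^{rel ∞}(W)` and the two inequalities, unconditionally -/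

section Bounds

variable (W : WeierstrassCurve ℚ) [W.IsElliptic] [W.IsGloballyMinimal]

/-- **`max(#Sel₂(W), #Sel₂(W^{(d)})) = #Sel₂^{rel ∞}(W)`** for `Δ_W > 0`, `E(ℚ)[2] = 0`, `d` descent-admissible: by THEOREM A's DECIDED dichotomy exactly one of
`Sel₂(W)`, `Sel_𝔓(A_χ)` (`≅ Sel₂(W^{(d)})`) is the `∞`-relaxed group and the other the `∞`-strict one, of index `2`.
[cite: Kramer1981, Prop. 6, Thm. 1] [cite: MazurRubin2010, Lemma 3.2, Prop 3.3] -/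
theorem max_selmerTwoCard_twistSelmerTwoCard_eq_natCard_relaxed (hΔ : 0 < W.Δ) (hT : NoRationalTwoTorsion W) {d : ℤ}
    (hd : DescAdmissible W d) :
    max (selmerTwoCard W) (twistSelmerTwoCard W d) = Nat.card (selmerGroupRelaxedAtInfinityAtTwo W) := by
  have hd0 : d ≠ 0 := hd.1.ne
  obtain ⟨χ, hχ⟩ := GenusKolyTransp.quadraticCharacterExists_holds d
  set w : InfinitePlace ℚ := Rat.infinitePlace with hw
  -- `#Sel₂^{rel ∞} = 2 · #Sel₂^{str ∞}`
  have hidx := relIndex_kummerStrict_selmerGroupRelaxedAtInfinityAtTwo_eq_two_of_Δ_pos W hΔ w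
  have hle : (kummerStrict W 2 {(Sum.inl w : Place ℚ)}).selmerGroup ≤ selmerGroupRelaxedAtInfinityAtTwo W :=
    (selmerGroup_kummerStrict_singleton_inl_le_selmerGroup W _).trans
      (Summit.BirchSwinnertonDyer.Rank1Residual.F1Sign2.selmerGroup_le_selmerGroupRelaxedAtInfinityAtTwo W)
  have hRS : Nat.card ((kummerStrict W 2 {(Sum.inl w : Place ℚ)}).selmerGroup) * 2 =
      Nat.card (selmerGroupRelaxedAtInfinityAtTwo W) := by
    have h0 := natCard_mul_relIndex_eq_natCard hle
    rwa [hidx] at h0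
  have htw : twistSelmerTwoCard W d = Nat.card (PrimeTwist.selmerGroup W χ) :=
    (natCard_primeTwist_selmerGroup_eq_twistSelmerTwoCard W hd0 hχ).symm
  have hS : selmerTwoCard W = Nat.card (W.selmerGroup ((2 : ℕ) : ℤ)) := rfl
  rcases primeTwist_selmerGroup_eq_relaxed_or_eq_kummerStrict_decided W hΔ hT hd hχ w with ⟨hall, hP⟩ | ⟨hex, hP⟩
  · -- UP end: `Sel_𝔓 = Sel₂^{rel ∞}`, `Sel₂(W) = Sel₂^{str ∞}`
    have hSel : W.selmerGroup ((2 : ℕ) : ℤ) = (kummerStrict W 2 {(Sum.inl w : Place ℚ)}).selmerGroup := by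
      rcases selmerGroup_eq_kummerStrict_or_eq_relaxed_of_Δ_pos W hΔ w with h | h
      · exact h
      · exfalso
        -- `Sel₂(W) = Sel₂^{rel ∞}` contains a class non-trivial at `∞` (index `2` over the strict group), contradicting `hall`
        have hne : (kummerStrict W 2 {(Sum.inl w : Place ℚ)}).selmerGroup ≠ selmerGroupRelaxedAtInfinityAtTwo W := by
          intro heq
          have h1 : (kummerStrict W 2 {(Sum.inl w : Place ℚ)}).selmerGroup.relIndex (selmerGroupRelaxedAtInfinityAtTwo W) = 1 := by
            rw [heq, AddSubgroup.relIndex_self]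
          rw [h1] at hidx
          exact absurd hidx (by norm_num)
        obtain ⟨c, hcR, hcS⟩ : ∃ c ∈ selmerGroupRelaxedAtInfinityAtTwo W, c ∉ (kummerStrict W 2 {(Sum.inl w : Place ℚ)}).selmerGroup := by
          by_contra hno
          push Not at hno
          exact hne (le_antisymm hle hno)
        have hc0 := hall c (h ▸ hcR)
        exact hcS ((mem_selmerGroup_kummerStrict_singleton_inl_iff W w c).mpr ⟨hcR, hc0⟩)
    have h1 : selmerTwoCard W = Nat.card ((kummerStrict W 2 {(Sum.inl w : Place ℚ)}).selmerGroup) := by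
      rw [hS, hSel]; exact rfl
    have h2 : twistSelmerTwoCard W d = Nat.card (selmerGroupRelaxedAtInfinityAtTwo W) := by rw [htw, hP]
    rw [h1, h2]
    exact max_eq_right (by omega)
  · -- DOWN end: `Sel_𝔓 = Sel₂^{str ∞}`, `Sel₂(W) = Sel₂^{rel ∞}`
    have hSel : W.selmerGroup ((2 : ℕ) : ℤ) = selmerGroupRelaxedAtInfinityAtTwo W := by
      rcases selmerGroup_eq_kummerStrict_or_eq_relaxed_of_Δ_pos W hΔ w with h | h
      · exfalso
        obtain ⟨c, hc, hne⟩ := hex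
        rw [h] at hc
        exact hne ((mem_selmerGroup_kummerStrict_singleton_inl_iff W w c).mp hc).2
      · exact h
    have h1 : selmerTwoCard W = Nat.card (selmerGroupRelaxedAtInfinityAtTwo W) := by rw [hS, hSel]
    have h2 : twistSelmerTwoCard W d = Nat.card ((kummerStrict W 2 {(Sum.inl w : Place ℚ)}).selmerGroup) := by
      rw [htw, hP]; exact rfl
    rw [h1, h2]
    exact max_eq_left (by omega)

variable (K : Type) [Field K] [NumberField K]

/-- **The two inequalities of DESC-29-M, UNCONDITIONALLY**: for `W/ℚ` globally minimal with `E(ℚ)[2] = 0` and `K` a door field of `W`,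
`max(#Sel₂ W, #Sel₂ W^{(d_K)}) ≤ #Sel₂(W_K/K)` and `2·#Sel₂(W_K/K) ≤ max(#Sel₂ W, #Sel₂ W^{(d_K)})²` — i.e. `u ≤ k ≤ 2u − 1`: file 53's count skeleton
`#Sel₂(W_K/K) = #Sel₂^{rel ∞}(W)·r`, `1 ≤ r ≤ #Sel₂^{str ∞}(W) = #Sel₂^{rel ∞}(W)/2`, with `max = #Sel₂^{rel ∞}(W)` (§222) and `Δ_W > 0` forced by the
door (tree `RankOneAtTwoOneDoor.doorForcesArchimedeanAtTwo_holds`). No `h14`, no finiteness, no Monsky. [cite: Kramer1981, Thm. 1, Prop. 6, Prop. 7]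
[cite: MazurRubin2010, Lemma 3.2] -/
theorem doorFieldSelmerBounds_of_isDoorField (hT : NoRationalTwoTorsion W) (hK : IsDoorField W K) :
    max (selmerTwoCard W) (twistSelmerTwoCard W (NumberField.discr K)) ≤ fieldSelmerTwoCard W K ∧
      2 * fieldSelmerTwoCard W K ≤ (max (selmerTwoCard W) (twistSelmerTwoCard W (NumberField.discr K))) ^ 2 := by
  obtain ⟨h2, hd⟩ := hK
  have hΔ : 0 < W.Δ := RankOneAtTwoOneDoor.doorForcesArchimedeanAtTwo_holds W (NumberField.discr K) hd
  obtain ⟨i, -, hi⟩ := exists_sq_eq_discr_not_mem_range K h2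
  have hi' : i ^ 2 = ((NumberField.discr K : ℤ) : K) := by rw [hi, map_intCast]
  have hmax := max_selmerTwoCard_twistSelmerTwoCard_eq_natCard_relaxed W hΔ hT hd
  obtain ⟨r, ⟨a, rfl⟩, hr, hcount⟩ := natCard_selmerGroup_baseChange_two_eq_relaxed_mul W K hT hd h2 hi'
  have hidx := relIndex_kummerStrict_selmerGroupRelaxedAtInfinityAtTwo_eq_two_of_Δ_pos W hΔ Rat.infinitePlace
  have hle : (kummerStrict W 2 {(Sum.inl Rat.infinitePlace : Place ℚ)}).selmerGroup ≤ selmerGroupRelaxedAtInfinityAtTwo W :=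
    (selmerGroup_kummerStrict_singleton_inl_le_selmerGroup W _).trans
      (Summit.BirchSwinnertonDyer.Rank1Residual.F1Sign2.selmerGroup_le_selmerGroupRelaxedAtInfinityAtTwo W)
  have hRS : Nat.card ((kummerStrict W 2 {(Sum.inl Rat.infinitePlace : Place ℚ)}).selmerGroup) * 2 =
      Nat.card (selmerGroupRelaxedAtInfinityAtTwo W) := by
    have h0 := natCard_mul_relIndex_eq_natCard hle
    rwa [hidx] at h0
  have hF : fieldSelmerTwoCard W K = Nat.card ((W.baseChange K).selmerGroup ((2 : ℕ) : ℤ)) := rfl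
  rw [hmax, hF, hcount]
  have ha1 : 1 ≤ 2 ^ a := Nat.one_le_two_pow
  constructor
  · calc Nat.card (selmerGroupRelaxedAtInfinityAtTwo W) = Nat.card (selmerGroupRelaxedAtInfinityAtTwo W) * 1 := (mul_one _).symm
      _ ≤ Nat.card (selmerGroupRelaxedAtInfinityAtTwo W) * 2 ^ a := Nat.mul_le_mul_left _ ha1
  · calc 2 * (Nat.card (selmerGroupRelaxedAtInfinityAtTwo W) * 2 ^ a)
        = Nat.card (selmerGroupRelaxedAtInfinityAtTwo W) * (2 ^ a * 2) := by ring
      _ ≤ Nat.card (selmerGroupRelaxedAtInfinityAtTwo W) *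
          (Nat.card ((kummerStrict W 2 {(Sum.inl Rat.infinitePlace : Place ℚ)}).selmerGroup) * 2) :=
        Nat.mul_le_mul_left _ (Nat.mul_le_mul_right 2 hr)
      _ = Nat.card (selmerGroupRelaxedAtInfinityAtTwo W) ^ 2 := by rw [hRS, sq]

end Bounds

/-! ## §223 DESC-29-M BY NAME behind `h14` -/

/-- **DESC-29-M `F1Sign2.DoorFieldSelmerBoundsAtTwo` BY NAME, behind `h14`**: the two inequalities are §222 (unconditional); the parity clause
`¬ IsSquare (#Sel₂(W_K/K))` is file 52's `not_isSquare_fieldSelmerTwoCard_of_monsky` (Kramer Thm. 1 parity + Thm. 2 as the tree's named fact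
`Monsky1996_lemma14b_twoSelmerRank_parity`, NOT proved here). CONDITIONAL on `h14`; BSD is not proved by this. [cite: Kramer1981, Thm. 1, Prop. 7, Thm. 2]
[cite: Monsky1996, Lemma 1.4(b)] -/
theorem doorFieldSelmerBoundsAtTwo_of_monsky (h14 : Monsky1996_lemma14b_twoSelmerRank_parity) : DoorFieldSelmerBoundsAtTwo := by
  intro W _ _ hT K _ _ hK
  obtain ⟨h1, h2⟩ := doorFieldSelmerBounds_of_isDoorField W K hT hK
  exact ⟨h1, h2, not_isSquare_fieldSelmerTwoCard_of_monsky W K h14 hT hK⟩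

end Summit.BirchSwinnertonDyer.BirchSwinnertonDyer.Theorems.GenusKolyArch

end
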